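import Mathlib
import HarnessLib
import Summits.HubbardSuperconductivity.HubbardSuperconductivity.Theorems.KLProgrammeKLRegimeTwoVolumeTowerSpineStep
import Summits.HubbardSuperconductivity.HubbardSuperconductivity.Theorems.KLProgrammeKLRegimeTwoVolumeTransferTailsWt
import Summits.HubbardSuperconductivity.HubbardSuperconductivity.Theorems.KLProgrammeKLRegimeTwoVolumeSubstitutionGluingDeepPin
import Summits.HubbardSuperconductivity.HubbardSuperconductivity.Theorems.KLProgrammeKLRegimeTwoVolumeDataKitWt
import Summits.HubbardSuperconductivity.HubbardSuperconductivity.Theorems.KLProgrammeKLRegimeTwoVolumeDoubledBlockData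
import Summits.HubbardSuperconductivity.HubbardSuperconductivity.Theorems.KLProgrammeKLRegimeTwoVolumeTowerEndTransfer
import Summits.HubbardSuperconductivity.HubbardSuperconductivity.Theorems.KLProgrammeKLRegimeTwoVolumeTowerTruncSpineStepSW
import Summits.HubbardSuperconductivity.HubbardSuperconductivity.Theorems.KLProgrammeKLRegimeTwoVolumeSourceSmoothStateKit

/-!
# [«(VL)-SRC-WINDOW» SW twin (k3c4-p1 g16, filed by g17 under the pen's (R235) «KEY = WINDOW»): `klTowerStateS ↦ klTowerStateSW` etc.; proofs token-identical]
# Route `KLProgramme` — crux K3, VL child `KLRegimeVolumeLimitV17F2` (stmt-HubbardSuperconductivity-20440), blueprint v5 M5 / W6-TS: THE END TRANSFER ON THE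
# SOURCE-RESCALED TRUNCATED TOWER (located «SRC-DEG2», cure (β) of plan g22 (R171); seat hubbard-kl-k3c4-p1 g15; `--supports` 20440)

Twin of `…TwoVolumeTowerTruncEndTransfer.towerTrunc_keyedDefect_map_transfer_le` (p618921) for the rescaled truncated states `srcTrunc 3 (klTowerStateSW … t J)`:
the keyed defect of the top rescaled truncated states, pushed through the common-frame transfer `klTowerTransfer … Kc J` (gluing bracket of
`…TransferTailsWt` with the nine transfer data of `TowerCrossData.transfer`), is at most `ε ×` the volume-free transfer form in the majorant `Ej` of
`klKeyedDefectTSW … t J` at the deep pins and the raw profiles `ε·NS J` of the two rescaled truncated states.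

* **`towerTruncSW_keyedDefect_map_transfer_le`**.

Proofs only; no definition.
-/

noncomputable section

namespace Summit.HubbardSuperconductivity.HubbardSuperconductivity.Theorems.TwoVolumeSource

set_option linter.dupNamespace false -- summit = problem name (single-conjunct summit), D-0017

open Finset Literature.MathematicalPhysics.QuantumLattice GrassmannAlgebra Literature.Probability.LatticeModels
  Literature.Probability.LatticeModels.BattleFederbush
open Summit.HubbardSuperconductivity.HubbardSuperconductivity.Theorems.TwoPointAssembly
open Summit.HubbardSuperconductivity.HubbardSuperconductivity.Theorems.KLRegimeSplit
open Summit.HubbardSuperconductivity.HubbardSuperconductivity.Theorems.KLProgrammeLegKernels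
open Summit.HubbardSuperconductivity.HubbardSuperconductivity.Theorems.EngineV8
open Summit.HubbardSuperconductivity.HubbardSuperconductivity.Theorems.TwoVolumeDefect

/-! ## §2 The keyed defect of the top states through the common-frame transfer -/

set_option maxHeartbeats 400000 in -- the nine transfer data and the gluing bracket in one declaration
/-- **THE END TRANSFER ON THE SOURCE-RESCALED TRUNCATED TOWER** (see the module docstring). [folklore: the transfer half of the per-scale step; cite: BenfattoGiulianiMastropietro2006, §3 (3.2)-(3.8)] -/
theorem towerTruncSW_keyedDefect_map_transfer_le {L b M : ℕ} [NeZero L] [NeZero (b * L)] [NeZero M] (β U μ : ℝ) (hβ : β ≠ 0) (Kc Kf : TrigPolyC4v) (t : ℝ) (J : ℕ)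
    {ε : ℝ} (hε : 0 < ε) (Λ κ' aW' sW' eW' ΛT cW κf sE cR cC δ : ℕ → ℝ) (NS : ℕ → ℕ → ℝ)
    (hX : TowerCrossData L b M β μ Kc Kf J ε Λ κ' aW' sW' eW' ΛT cW κf sE cR cC δ) (hΛ₁ : 0 ≤ Λ (J - 1)) (hNSJ0 : ∀ k, 0 ≤ NS J k)
    (hSc : WtProfileRaw (srcTrunc ℂ (fun q : SrcLabel L M (J - 1) => q.2 = 1) 3 (klTowerStateSW L M β U μ Kc t J)) (Λ (J - 1)) (fun k => ε * NS J k))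
    (hSf : WtProfileRaw (srcTrunc ℂ (fun q : SrcLabel (b * L) M (J - 1) => q.2 = 1) 3 (klTowerStateSW (b * L) M β U μ Kf t J)) (Λ (J - 1)) (fun k => ε * NS J k))
    (D₀ r : ℕ) (hD₀ : 2 * r ≤ D₀) (Ej : ℕ → ℝ) (hEj0 : ∀ k, 0 ≤ Ej k)
    (hEj : ∀ (k : ℕ) (p' : Fin k) (y' : SrcLabel (b * L) M (J - 1)), (∀ i, D₀ ≤ (y'.1.1.2 i).val % L ∧ (y'.1.1.2 i).val % L + D₀ < L) →
      klKeyedDefectTSW L b M β U μ Kc Kf t J k p' y' ≤ ε * Ej k)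
    (n : ℕ) (p : Fin (n + 1)) (w : SrcLabel (b * L) M J) (hw : ∀ i, D₀ + r ≤ (w.1.1.2 i).val % L ∧ (w.1.1.2 i).val % L + (D₀ + r) < L) :
    ∑ X ∈ univ.filter (fun X : Fin (n + 1) → SrcLabel (b * L) M J => X p = w),
        ‖kernel ℂ (ExteriorAlgebra.map (Matrix.toLin' (klTowerTransfer (b * L) M β μ Kc J))
            (srcTrunc ℂ (fun q : SrcLabel (b * L) M (J - 1) => q.2 = 1) 3 (klTowerStateSW (b * L) M β U μ Kf t J))) (n + 1) X -
          (if ∀ i, (klBlockEquivD L b M J (X i)).1 = (klBlockEquivD L b M J (X p)).1 then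
            kernel ℂ (ExteriorAlgebra.map (Matrix.toLin' (klTowerTransfer L M β μ Kc J))
              (srcTrunc ℂ (fun q : SrcLabel L M (J - 1) => q.2 = 1) 3 (klTowerStateSW L M β U μ Kc t J))) (n + 1)
              (fun i => (klBlockEquivD L b M J (X i)).2) else 0)‖ ≤
      ε * (cW J ^ n * (cW J * Ej (n + 1) + cW J / (1 + ΛT J * ((r : ℝ) + 1)) * (NS J (n + 1) + NS J (n + 1))) +
        (2 * cW J ^ n * (cW J / (1 + ΛT J * ((r : ℝ) + 1))) * NS J (n + 1) +
          (n : ℝ) * cW J ^ n * (5 * (cW J / (1 + ΛT J * ((r : ℝ) + 1))) * NS J (n + 1) + 2 * cW J * ((1 + Λ (J - 1) * ((r : ℝ) + 1))⁻¹ * NS J (n + 1))))) := by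
  classical
  -- §0 names, signs, the block structures
  haveI : NeZero b := ⟨fun h => NeZero.ne (b * L) (by rw [h, zero_mul])⟩
  set ed := klBlockEquivD L b M J with hed_def
  set ed₁ := klBlockEquivD L b M (J - 1) with hed₁_def
  set Tpf := klTowerTransfer (b * L) M β μ Kc J with hTpf_def
  set Tpc := klTowerTransfer L M β μ Kc J with hTpc_def
  set 𝒲' := srcTrunc ℂ (fun q : SrcLabel (b * L) M (J - 1) => q.2 = 1) 3 (klTowerStateSW (b * L) M β U μ Kf t J) with h𝒲'_def
  set 𝒲 := srcTrunc ℂ (fun q : SrcLabel L M (J - 1) => q.2 = 1) 3 (klTowerStateSW L M β U μ Kc t J) with h𝒲_def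
  have htr := hX.transfer J le_rfl
  have hΛT := htr.ΛT_nonneg
  have hcW := htr.cW_nonneg
  have hrowT : ∀ x : SrcLabel (b * L) M J, ∑ y', ‖Tpf x y'‖ * (1 + ΛT J * (Torus.tnorm (x.1.1.2 - y'.1.1.2) : ℝ)) ≤ cW J := htr.row
  have hcolT : ∀ y' : SrcLabel (b * L) M (J - 1), ∑ x, ‖Tpf x y'‖ * (1 + ΛT J * (Torus.tnorm (x.1.1.2 - y'.1.1.2) : ℝ)) ≤ cW J := htr.col
  have hcovT : ∀ (δ β' β : Fin 2 → Fin b) (xbar : SrcLabel L M J) (y : SrcLabel L M (J - 1)),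
      ‖Tpf (ed.symm (β' + δ, xbar)) (ed₁.symm (β + δ, y))‖ = ‖Tpf (ed.symm (β', xbar)) (ed₁.symm (β, y))‖ := htr.cov
  have hed1 : ∀ (x : SrcLabel (b * L) M J) i, ((ed x).1 i : ℕ) = (x.1.1.2 i).val / L := fun x i => by
    obtain ⟨x, s⟩ := x; rw [hed_def, klBlockEquivD_apply]; exact klBlockEquiv_val L b M _ x i
  have hed₁1 : ∀ (y' : SrcLabel (b * L) M (J - 1)) i, ((ed₁ y').1 i : ℕ) = (y'.1.1.2 i).val / L := fun y' i => by
    obtain ⟨y, s⟩ := y'; rw [hed₁_def, klBlockEquivD_apply]; exact klBlockEquiv_val L b M _ y i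
  have hed2s : ∀ x : SrcLabel (b * L) M J, (fun Y : SrcLabel L M J => Y.1.1.2) (ed x).2 = fun i => ((((x.1.1.2 i).val : ℕ)) : ZMod L) := fun x => by
    obtain ⟨x, s⟩ := x; rw [hed_def, klBlockEquivD_apply]; dsimp only; rw [klBlockEquiv_snd]
  have hed₁2s : ∀ y' : SrcLabel (b * L) M (J - 1), (fun Y : SrcLabel L M (J - 1) => Y.1.1.2) (ed₁ y').2 = fun i => ((((y'.1.1.2 i).val : ℕ)) : ZMod L) :=
    fun y' => by obtain ⟨y, s⟩ := y'; rw [hed₁_def, klBlockEquivD_apply]; dsimp only; rw [klBlockEquiv_snd]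
  -- §1 the nine transfer data (`aT := cW`, `τT := cW/(1+Λ_T(r+1))`), regions `R := D₀ + r`, `RN := r`, `RZ := 2r`, `RF := r`
  have hτT : 0 ≤ cW J / (1 + ΛT J * ((r : ℝ) + 1)) := by positivity
  have hTcol := transfer_col_le (fun x : SrcLabel (b * L) M J => x.1.1.2) (fun y' : SrcLabel (b * L) M (J - 1) => y'.1.1.2) Tpf hΛT hcolT
  have hTwin := transfer_win_le (fun x : SrcLabel (b * L) M J => x.1.1.2) (fun y' : SrcLabel (b * L) M (J - 1) => y'.1.1.2) Tpf hΛT hcolT ed ed₁ hcovT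
  have hTρ := transfer_rho_le (fun x : SrcLabel (b * L) M J => x.1.1.2) (fun y' : SrcLabel (b * L) M (J - 1) => y'.1.1.2) Tpf hΛT hrowT ed ed₁
  have hTrowF := transfer_rowF_le (fun x : SrcLabel (b * L) M J => x.1.1.2) (fun y' : SrcLabel (b * L) M (J - 1) => y'.1.1.2) Tpf hΛT hrowT r
  have hTτF := transfer_tauF_le (fun x : SrcLabel (b * L) M J => x.1.1.2) (fun y' : SrcLabel (b * L) M (J - 1) => y'.1.1.2) Tpf hΛT hrowT hcW (le_refl r)
  have hTτ2 := transfer_tau2_le (fun x : SrcLabel (b * L) M J => x.1.1.2) (fun y' : SrcLabel (b * L) M (J - 1) => y'.1.1.2) Tpf hΛT hrowT hcW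
    (rfl : b * L = b * L) ed ed₁ hed1 hed₁1 (Nat.le_add_left r D₀) w hw
  have hTτ3 := transfer_tau3_le (fun x : SrcLabel (b * L) M J => x.1.1.2) (fun y' : SrcLabel (b * L) M (J - 1) => y'.1.1.2) Tpf hΛT hrowT hcW
    (rfl : b * L = b * L) ed ed₁ (fun Y : SrcLabel L M J => Y.1.1.2) (fun Y : SrcLabel L M (J - 1) => Y.1.1.2) hed2s hed₁2s (le_refl r) w
  have hTτ1 := transfer_tau1_le (fun x : SrcLabel (b * L) M J => x.1.1.2) (fun y' : SrcLabel (b * L) M (J - 1) => y'.1.1.2) Tpf hΛT hcolT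
    (rfl : b * L = b * L) ed ed₁ hed1 hed₁1 (fun Y : SrcLabel L M J => Y.1.1.2) (fun Y : SrcLabel L M (J - 1) => Y.1.1.2) hed2s hed₁2s
    (RZ := 2 * r) (by omega : r + 2 * r ≤ D₀ + r) w hw
  have hTτ4 := transfer_tau4_le (fun x : SrcLabel (b * L) M J => x.1.1.2) (fun y' : SrcLabel (b * L) M (J - 1) => y'.1.1.2) Tpf hΛT hcolT
    (rfl : b * L = b * L) ed ed₁ hed1 hed₁1 (fun Y : SrcLabel L M J => Y.1.1.2) (fun Y : SrcLabel L M (J - 1) => Y.1.1.2) hed2s hed₁2s hcovT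
    (RZ := 2 * r) (by omega : r + 2 * r ≤ D₀ + r) w hw
  -- §2 the block embeddings and the periodisation of the transfers
  set Fe : (Fin 2 → Fin b) → (SrcLabel L M J → ℂ) →ₗ[ℂ] (SrcLabel (b * L) M J → ℂ) := fun β' =>
    LinearMap.pi (fun X' : SrcLabel (b * L) M J => if (ed X').1 = β' then (LinearMap.proj (ed X').2 : (SrcLabel L M J → ℂ) →ₗ[ℂ] ℂ) else 0) with hFe_def
  have hFe : ∀ β' v X', Fe β' v X' = if (ed X').1 = β' then v (ed X').2 else 0 := fun β' v X' => blockEmb_pi_apply ℂ ed β' v X'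
  set Fe₁ : (Fin 2 → Fin b) → (SrcLabel L M (J - 1) → ℂ) →ₗ[ℂ] (SrcLabel (b * L) M (J - 1) → ℂ) := fun β' =>
    LinearMap.pi (fun X' : SrcLabel (b * L) M (J - 1) => if (ed₁ X').1 = β' then (LinearMap.proj (ed₁ X').2 : (SrcLabel L M (J - 1) → ℂ) →ₗ[ℂ] ℂ) else 0)
    with hFe₁_def
  have hFe₁ : ∀ β' v X', Fe₁ β' v X' = if (ed₁ X').1 = β' then v (ed₁ X').2 else 0 := fun β' v X' => blockEmb_pi_apply ℂ ed₁ β' v X'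
  have hPT : ∀ (X' : SrcLabel (b * L) M J) (Y : SrcLabel L M (J - 1)),
      ∑ Y'' ∈ univ.filter (fun Y'' : SrcLabel (b * L) M (J - 1) => (ed₁ Y'').2 = Y), Tpf X' Y'' = Tpc (ed X').2 Y :=
    fun X' Y => klTowerTransfer_periodise (rfl : b * L = b * L) hβ μ Kc J (klBlockEquiv L b M (sectorCount J)) (klBlockEquiv_snd L b M _) ed
      (klBlockEquivD_apply L b M J) (klBlockEquiv L b M (sectorCount (J - 1))) (klBlockEquiv_snd L b M _) ed₁ (klBlockEquivD_apply L b M (J - 1)) X' Y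
  -- §3 the transfer triangle, the coarse profiles (plain and far), the two-volume data in glued form
  have hZT : ∀ y y' : SrcLabel L M (J - 1), Torus.tnorm ((ed w).2.1.1.2 - y.1.1.2) ≤ r → 2 * r < Torus.tnorm ((ed w).2.1.1.2 - y'.1.1.2) →
      r < Torus.tnorm (y.1.1.2 - y'.1.1.2) := by
    intro y y' hy hy'
    have htri := Torus.tnorm_add_le ((ed w).2.1.1.2 - y.1.1.2) (y.1.1.2 - y'.1.1.2)
    rw [sub_add_sub_cancel] at htri; omega
  have hNj : ∀ y : SrcLabel L M (J - 1), ∑ Y ∈ univ.filter (fun Y : Fin (n + 1) → SrcLabel L M (J - 1) => Y p = y), ‖kernel ℂ 𝒲 (n + 1) Y‖ ≤ ε * NS J (n + 1) :=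
    fun y => hSc.unweighted (n + 1) p y
  have hNfarj : ∀ (y : SrcLabel L M (J - 1)) (i : Fin (n + 1)),
      ∑ Y ∈ univ.filter (fun Y : Fin (n + 1) → SrcLabel L M (J - 1) => Y p = y ∧ r < Torus.tnorm ((Y p).1.1.2 - (Y i).1.1.2)), ‖kernel ℂ 𝒲 (n + 1) Y‖ ≤
        (1 + Λ (J - 1) * ((r : ℝ) + 1))⁻¹ * (ε * NS J (n + 1)) :=
    fun y i => sum_far_norm_kernel_le_of_scaledWeighted (fun Y : SrcLabel L M (J - 1) => Y.1.1.2) 𝒲 hΛ₁ (n + 1) p y i r (hSc.le (n + 1) p y)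
  have hsub₁ : ∀ (q : Fin (n + 1)) (Y' : Fin (n + 1) → SrcLabel (b * L) M (J - 1)),
      kernel ℂ (∑ β', ExteriorAlgebra.map (Fe₁ β') 𝒲) (n + 1) Y' = if ∀ i, (ed₁ (Y' i)).1 = (ed₁ (Y' q)).1 then kernel ℂ 𝒲 (n + 1) (fun i => (ed₁ (Y' i)).2) else 0 :=
    fun q Y' => kernel_copies_sum ed₁ Fe₁ hFe₁ _ q Y'
  have hEj' : ∀ y' : SrcLabel (b * L) M (J - 1), Torus.tnorm (w.1.1.2 - y'.1.1.2) ≤ r →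
      ∑ Y' ∈ univ.filter (fun Y' : Fin (n + 1) → SrcLabel (b * L) M (J - 1) => Y' p = y'),
        ‖kernel ℂ (𝒲' - ∑ β', ExteriorAlgebra.map (Fe₁ β') 𝒲) (n + 1) Y'‖ ≤ ε * Ej (n + 1) := by
    intro y' hy'
    simp only [kernel_sub', hsub₁ p]
    have hdeep := deepRes_of_tnorm_le (b := b) (m := L) (Mf := b * L) rfl hw hy'
    have h := hEj (n + 1) p y' hdeep
    rw [klKeyedDefectTSW_eq] at h
    exact h
  have hNDj' : ∀ y' : SrcLabel (b * L) M (J - 1),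
      ∑ Y' ∈ univ.filter (fun Y' : Fin (n + 1) → SrcLabel (b * L) M (J - 1) => Y' p = y'),
        ‖kernel ℂ (𝒲' - ∑ β', ExteriorAlgebra.map (Fe₁ β') 𝒲) (n + 1) Y'‖ ≤ ε * (NS J (n + 1) + NS J (n + 1)) := by
    intro y'
    simp only [kernel_sub', hsub₁ p]
    have h := klKeyedDefectTSW_le_of_wtProfileRaw β U μ Kc Kf t J hSf hSc (n + 1) p y'
    rw [klKeyedDefectTSW_eq] at h
    exact h.trans (le_of_eq (by ring))
  -- §4 the gluing bracket
  have hsub : ∀ X : Fin (n + 1) → SrcLabel (b * L) M J,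
      kernel ℂ (∑ β', ExteriorAlgebra.map (Fe β') (ExteriorAlgebra.map (Matrix.toLin' Tpc) 𝒲)) (n + 1) X =
        if ∀ i, (ed (X i)).1 = (ed (X p)).1 then kernel ℂ (ExteriorAlgebra.map (Matrix.toLin' Tpc) 𝒲) (n + 1) (fun i => (ed (X i)).2) else 0 :=
    fun X => kernel_copies_sum ed Fe hFe _ p X
  simp_rw [← hsub]
  have hmain := sum_norm_kernel_map_sub_glue_map_le_of_defect ed₁ ed Tpc Tpf hPT Fe₁ hFe₁ Fe hFe 𝒲' 𝒲 p w
    (fun y : SrcLabel L M (J - 1) => 2 * r < Torus.tnorm ((ed w).2.1.1.2 - y.1.1.2))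
    (fun y : SrcLabel L M (J - 1) => Torus.tnorm ((ed w).2.1.1.2 - y.1.1.2) ≤ r)
    (fun y y' : SrcLabel L M (J - 1) => r < Torus.tnorm (y.1.1.2 - y'.1.1.2)) hZT
    (fun y' : SrcLabel (b * L) M (J - 1) => Torus.tnorm (w.1.1.2 - y'.1.1.2) ≤ r)
    hcW hτT (mul_nonneg hε.le (hNSJ0 _)) (mul_nonneg (inv_nonneg.2 (by positivity)) (mul_nonneg hε.le (hNSJ0 _))) (mul_nonneg hε.le (hEj0 _))
    (mul_nonneg hε.le (add_nonneg (hNSJ0 _) (hNSJ0 _)))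
    hTcol hTwin (hTρ w) (hTrowF w) (hTτF w) (fun y hy => hTτ1 y hy) hTτ2 (hTτ3) (fun y hy => hTτ4 y hy) hNj hNfarj hEj' hNDj'
  refine hmain.trans (le_of_eq ?_)
  ring

end Summit.HubbardSuperconductivity.HubbardSuperconductivity.Theorems.TwoVolumeSource

end
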